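import Summits.PneNP.PneNP.Theses.KarlinRubin

/-!
# Stub `stub_acceptanceSplit` (crux `MonotoneBlind`, stmt-PneNP-18027, line `Sketch`)

Acceptance and rejection of a Boolean test `f` are complementary events of the probability mass
function `plantedCliqueDist n k`: `Pr_P[f = 1] + Pr_P[f = 0] = 1`. Pure `PMF` bookkeeping:
`PMF.toOuterMeasure_apply` writes both masses as `tsum`s of indicators, the indicator functions of the
partition `{f = 1} ⊔ {f = 0}` add up to the mass function pointwise (case split on `f x`), and
`PMF.tsum_coe` evaluates the total to `1`. (The general fact `Pr[S] + Pr[Sᶜ] = 1` is landed in several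
far-away cones, e.g. `Literature/Computability/Cryptography/PeikertMachineAnalysis.lean`; it is re-derived
in three lines here rather than importing lattice cryptography into this cone.)
-/

set_option linter.dupNamespace false -- `Summit.PneNP.PneNP.…` is the layout-mandated namespace

namespace Summit.PneNP.PneNP.Theorems.MonotoneBlind.VertexCover

open Literature.Computability.Complexity Literature.Probability.RandomGraphs.PlantedClique Filter Finset
open scoped ENNReal Topology Classical

/-- **stub_acceptanceSplit**. Acceptance and rejection are complementary events of the probability
mass function `plantedCliqueDist n k`: `Pr_P[f = 1] + Pr_P[f = 0] = 1` for every Boolean test `f` on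
edge vectors (`PMF.toOuterMeasure_apply`, `ENNReal.tsum_add`, pointwise case split on `f x`,
`PMF.tsum_coe`). [folklore] -/
theorem stub_acceptanceSplit :
    ∀ (n k : ℕ) (f : EdgeVec n → Bool),
      (plantedCliqueDist n k).toOuterMeasure {y | f y = true} +
        (plantedCliqueDist n k).toOuterMeasure {y | f y = false} = 1 := by
  intro n k f
  rw [PMF.toOuterMeasure_apply, PMF.toOuterMeasure_apply, ← ENNReal.tsum_add,
    ← (plantedCliqueDist n k).tsum_coe]
  refine tsum_congr fun x => ?_
  cases hx : f x <;> simp [hx]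

end Summit.PneNP.PneNP.Theorems.MonotoneBlind.VertexCover
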